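import Literature.NumberTheory.Transcendental.LiouvilleStep
import Literature.NumberTheory.Transcendental.Extrapolation
import Literature.NumberTheory.Transcendental.ThetaBaseLowerBound
import Mathlib.Combinatorics.Nullstellensatz
import HarnessLib

/-!
# Baker's method on `M_κ`: the inductive step at a new point

Topic: `Literature/NumberTheory/Transcendental`. Plan item W4/S5(f, local part) of the unit
`provefact-Literature.NumberTheory.Transcendental.H-b596640137`. At a point `s·v` we prove, by
induction on the order `k < T'`, that the auxiliary form `F_P` (`P = homog D (QOf ξ)`) vanishes
to order `≥ T'` along `𝔟 = ⟨x_1, …, x_dd⟩`, GIVEN the analytic smallness of the extrapolation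
functions `φ_{x_c,k}(s)` for the grid directions `x_c = ∑ c_m x_m`, `c ∈ {0,…,k}^{dd}`
(hypothesis `hφ`, supplied by the extrapolation estimate of the sequel):

* lower levels `⇒ VanishesAlong 𝔟 F_P (s·v) k` (`vanishesAlong_of_levels`,
  `LineJetForms.vanishesAlong_span_of_wordForms` + `LineValues.emb_coeff_lineValPoly`);
* `⇒ φ_{x_c,k}(s) = Θ_{J₀}(s·v)^D · emb(p_{s,k}(c))` (`LineValues.iteratedDeriv_grid_eq`);
* smallness + Liouville `⇒ p_{s,k}(c) = 0` for all grid `c` (`LiouvilleStep`);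
* `⇒ p_{s,k} = 0` (Alon's grid lemma, Mathlib `MvPolynomial.eq_zero_of_eval_zero_at_prod_finset`,
  `deg_{c_m} p_{s,k} ≤ k`), i.e. level `k` holds.

Main result: `BakerData.vanishesAlong_of_small` — `VanishesAlong 𝔟 F_P (s·v) T'`.

## References

* A. Baker, G. Wüstholz, *Logarithmic Forms and Diophantine Geometry*, CUP 2007, §6.8 (p. 119).
-/

noncomputable section

open Complex MvPolynomial Finset NumberField
open scoped PeriodPair

namespace Literature.NumberTheory.Transcendental

namespace GaGmE

namespace Std

namespace BakerData

variable {β γ δ : Type} [Fintype β] [Fintype γ] [Fintype δ] [DecidableEq γ]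
variable [DecidableEq β] [DecidableEq δ] (B : BakerData β γ δ)

/-- The analytic subgroup direction space `𝔟 = ⟨x_1, …, x_dd⟩`. [folklore] -/
abbrev bSpan : Submodule ℂ (β ⊕ (γ ⊕ δ) → ℂ) := Submodule.span ℂ (Set.range B.xs)

/-- The grid directions `x_c = ∑ c_m x_m`. [folklore] -/
def gridDir (cg : Fin B.dd → ℕ) : β ⊕ (γ ⊕ δ) → ℂ := ∑ m, (cg m : ℂ) • B.xs m

omit [DecidableEq β] [DecidableEq δ] in
/-- Grid directions lie in `𝔟`. [folklore] -/
theorem gridDir_mem (cg : Fin B.dd → ℕ) : B.gridDir cg ∈ B.bSpan :=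
  Submodule.sum_mem _ fun m _ => Submodule.smul_mem _ _ (Submodule.subset_span ⟨m, rfl⟩)

/-- The auxiliary form attached to `ξ`: `P = homog (nD') (QOf ξ)`. [folklore] -/
abbrev auxForm {D' : ℕ} (ξ : UIdx β γ δ D' → 𝓞 B.K) : MvPolynomial (Option β × ThetaIdx γ δ) ℂ :=
  homog (Fintype.card (β ⊕ (γ ⊕ δ)) * D') (B.QOf ξ)

/-- **Lower levels give vanishing along `𝔟`.** If `p_{s,k'} = 0` for all `k' < k` then `F_P`
vanishes to order `≥ k` along `𝔟` at `s·v`. [folklore] -/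
theorem vanishesAlong_of_levels {D' : ℕ} (ξ : UIdx β γ δ D' → 𝓞 B.K) (s : ℕ) {k : ℕ}
    (h : ∀ k' < k, B.lineValPoly ξ s k' = 0) :
    VanishesAlong B.bSpan (thetaEval B.L B.κM (B.auxForm ξ)) ((s : ℂ) • B.v) k := by
  refine vanishesAlong_span_of_wordForms B.L B.κM (isHomogeneous_homog _ _) (B.cAt s)
    (fun x => zero_mem_chartDomain_chartChoiceAt B.L _ x) B.xs k fun k' hk' α => ?_
  have e := B.emb_coeff_lineValPoly ξ s k' (fun m => (α m : ℕ))
  rw [h k' hk', coeff_zero, map_zero] at e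
  exact e.symm

/-- **The inductive step at a new point.** Let `s ∈ ℕ`, `T'`, and suppose that for every
`k < T'` and every grid direction `x_c` (`c_m ≤ k`) the extrapolation function satisfies
`|φ_{x_c,k}(s)| · |d_s|^{E} · (|d_s|^{E}·lineValBound)^{h-1} < |Θ_{J₀(c_s)}(s·v)|^D`. Then `F_P`
vanishes to order `≥ T'` along `𝔟` at `s·v`. [cite: BakerWustholz2007, §6.8 (p. 119)] -/
theorem vanishesAlong_of_small {D' : ℕ} (ξ : UIdx β γ δ D' → 𝓞 B.K) (s T' : ℕ)
    (hφ : ∀ k < T', ∀ cg : Fin B.dd → ℕ, (∀ m, cg m ≤ k) →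
      ‖extrapFun B.L B.κM (B.auxForm ξ) B.v (B.gridDir cg) k s‖ *
        (|(B.dAt s : ℝ)| ^ B.expE (Fintype.card (β ⊕ (γ ⊕ δ)) * D') k *
          (|(B.dAt s : ℝ)| ^ B.expE (Fintype.card (β ⊕ (γ ⊕ δ)) * D') k * B.lineValBound ξ s k) ^
            (B.gens.h - 1)) <
        ‖theta B.L B.κM (baseIdx (B.cAt s)) ((s : ℂ) • B.v)‖ ^ (Fintype.card (β ⊕ (γ ⊕ δ)) * D')) :
    VanishesAlong B.bSpan (thetaEval B.L B.κM (B.auxForm ξ)) ((s : ℂ) • B.v) T' := by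
  set D := Fintype.card (β ⊕ (γ ⊕ δ)) * D' with hD
  -- all levels below `T'` vanish, by strong induction
  have hlev : ∀ k < T', B.lineValPoly ξ s k = 0 := by
    intro k
    induction k using Nat.strong_induction_on with
    | _ k ih =>
      intro hk
      have hvan : VanishesAlong B.bSpan (thetaEval B.L B.κM (B.auxForm ξ)) ((s : ℂ) • B.v) k :=
        B.vanishesAlong_of_levels ξ s fun k' hk' => ih k' hk' (hk'.trans hk)
      -- every grid value vanishes
      have hgrid : ∀ cg : Fin B.dd → ℕ, (∀ m, cg m ≤ k) →
          MvPolynomial.eval (fun m => (cg m : B.K)) (B.lineValPoly ξ s k) = 0 := by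
        intro cg hcg
        have hlow : ∀ i < k, iteratedDeriv i (fun t : ℂ => thetaEval B.L B.κM (B.auxForm ξ)
            ((s : ℂ) • B.v + t • ∑ m, (cg m : ℂ) • B.xs m)) 0 = 0 :=
          fun i hi => hvan _ (B.gridDir_mem cg) i hi
        have hval := B.iteratedDeriv_grid_eq ξ s k cg hlow
        have hsmall := hφ k hk cg hcg
        -- `φ = Θ₀^D · emb p`
        have hφeq : extrapFun B.L B.κM (B.auxForm ξ) B.v (B.gridDir cg) k s =
            theta B.L B.κM (baseIdx (B.cAt s)) ((s : ℂ) • B.v) ^ D *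
              B.emb (MvPolynomial.eval (fun m => (cg m : B.K)) (B.lineValPoly ξ s k)) := hval
        rw [hφeq, norm_mul, norm_pow, mul_assoc] at hsmall
        have hΘ : 0 < ‖theta B.L B.κM (baseIdx (B.cAt s)) ((s : ℂ) • B.v)‖ ^ D := by
          obtain ⟨c, hc, C, -, hge⟩ := B.exists_theta_baseIdx_ge
          exact pow_pos (lt_of_lt_of_le (by have := hge s; positivity) (hge s)) D
        refine B.lineVal_eq_zero_of_norm_lt ξ s k hcg ?_
        have := (mul_lt_iff_lt_one_right hΘ).mp hsmall
        rw [← hD, mul_assoc]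
        exact this
      -- the grid lemma
      refine MvPolynomial.eq_zero_of_eval_zero_at_prod_finset _
        (fun _ => (Finset.range (k + 1)).image (fun j : ℕ => (j : B.K))) (fun m => ?_) (fun x hx => ?_)
      · rw [Finset.card_image_of_injective _ Nat.cast_injective, Finset.card_range]
        exact Nat.lt_succ_of_le (B.degreeOf_lineValPoly_le ξ s k m)
      · have hx' : ∀ m, ∃ j : ℕ, j ≤ k ∧ (j : B.K) = x m := fun m => by
          obtain ⟨j, hj, hjx⟩ := Finset.mem_image.mp (hx m)
          exact ⟨j, Nat.lt_succ_iff.mp (Finset.mem_range.mp hj), hjx⟩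
        choose cg hcg hcgx using hx'
        have hxe : x = fun m => (cg m : B.K) := funext fun m => (hcgx m).symm
        rw [hxe]
        exact hgrid cg hcg
  exact B.vanishesAlong_of_levels ξ s hlev

end BakerData

end Std

end GaGmE

end Literature.NumberTheory.Transcendental

end
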